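import Literature.MathematicalPhysics.QuantumFieldTheory.Balaban1983to89.T4BoundaryRate

/-!
# BoundaryRateScaleZero — the per-piece form of the boundary-member frame, the PRINTED BASE of its induction (run B's unpaired
first-step pieces), and the located reason for splitting `OpDisc` (cell `pub-balaban`, T⁴ fan-out, `HOME/BINDER-OWNERS.md` row
NE5, route P3 «boundary-functional member»; ROUND-2 skeleton `t4/skeletons/NE5-t4-ne5-p3.md` §3 L11 ∕ §7 row B4; lineage
t4-ne5-p3 gen 17; typing + bookkeeping only; imports the Literature leaf `T4BoundaryRate` (v1.6.2) ONLY and modifies nothing of it)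

HONEST FRAMING (T4-DAG PAGE 1; identical to the parent's).  The cell's T⁴ target is rung (B)+1: existence AND uniqueness of the
ε → 0 limit of Bałaban's unit-scale averaged loop expectations on a FIXED finite torus — strictly beyond ultraviolet stability,
NOT infinite volume, NOT a mass gap, NOT the Clay problem.  HONEST DEPENDENCY (cell line, verbatim): «continuum YM on T⁴ ⇐
BetaPertH ∧ nine spine estimates (0/9 proved); BetaPertH ⇐ (D1) ∧ (D4) ∧ CAP+tail; G-an2-4 gates asym, D1 and NE2/3/4.»  This
module asserts NOTHING about Bałaban's objects; every `def … : Prop` is a parametrised HYPOTHESIS SHAPE over the ABSTRACT carriers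
of `T4BoundaryCarrier`/`T4BoundaryRate`, every theorem is [folklore] bookkeeping.  `T4BoundaryCarrier.NE5B` is NOT PRINTED and is
NOT proved here.

WHAT THIS MODULE DOES.  Node U5b compares run A (K steps from spacing ε) with run B (K + 1 steps from ε/L); after node U5a's
synchronisation run A's creation step j is paired with run B's step j + 1 (`T4OutputRate.Carriers.scale`: *"creation step j of X
(run A numbering; paired with run B's step j + 1)"*), so run B's FIRST-step boundary pieces have NO partner in run A.  The
parent's induction `T4BoundaryRate.ne5B_of_generation` runs over ALL indices of the common carrier; the honest convention
(skeleton §3 L11 «BASE SCALE», §7 B4) is to index the unpaired pieces too, at indices where run A's functional VANISHES.  Then: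
* §1 `GenLipAt` — the parent's `GenLip` READ PER PIECE (`genLip_iff`, by `Iff.rfl`), and `NE5B` read per piece as the parent's
  `BDiscAt` with the rate profile (`ne5B_iff_bDiscAt`);
* §2 THE BASE IS PRINTED: at an unpaired piece (run A vanishes there: `VanishesOn`) with no parents, the two-run discrepancy IS
  run B's one-run size, so `GenLipAt` — and the target inequality itself — follow from the printed one-run bound (2.42) p. 261 of
  [Balaban1988Convergent] in its typed form `T4BoundaryCarrier.DecayBoundFl BB W B₀ κ` (a QUOTED leaf of the audited series, binder
  only) as soon as `B₀ ≤ Cop·θ^{scale X}` (`genLipAt_of_unpaired`, `bDiscAt_of_unpaired`); conversely `NE5B` restricted to the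
  unpaired pieces is nothing but such a one-run bound (`abs_le_of_ne5B_of_vanishesOn`);
* §3 THE LOCATED REASON FOR THE `OpDisc` SPLIT (`Support/BoundaryRateOpDisc`, p206646): at a piece with NO parents and NO regular
  inputs, under the readings `RepresentsA`/`RepresentsB`, the input modulus `InputLipB` and the admissibility of both runs' tables,
  the parent's two-run binder `OpDisc` evaluated at that piece IS the target inequality at that piece with `C₅ = Cop`
  (`opDisc_apply_eq_disc_of_noParents`, `bDiscAt_of_opDisc_of_noParents`) — so a skeleton listing `OpDisc` as a leaf must show its
  constituents, which p206646 does;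
* §4 re-assembly: `GenLip` from `GenLipAt` off the unpaired set and the printed base on it (`genLip_of_off_and_unpaired`).
Names used — parent `T4BoundaryRate`: `Generation`, `BDiscAt`, `EDiscAt`, `GenLip`, `RepresentsA`, `RepresentsB`, `InputLipB`,
`OpDisc`, `tabA`, `etabA`, `tabB`, `etabB`, `pullB`, `epullB`, `BTable`, `ETable`, `GenMap`; `T4BoundaryCarrier.NE5B`, `DecayBoundFl`,
`atFl_apply`, `BFunctional`; `T4OutputRate.NE5`, `DecayBound`, `Functional`; Mathlib: `Finset.sum_empty`, `abs_nonpos_iff`,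
`mul_le_mul_of_nonneg_right`.  Cell record: skeleton `t4/skeletons/NE5-t4-ne5-p3.md` §3 L11, §7 B4.
-/

namespace Summit.QuantumFields.BalabanUV.T4Continuum.BoundaryRateScaleZero

open Finset
open Literature.MathematicalPhysics.QuantumFieldTheory.Balaban1983to89
open T4OutputRate T4BoundaryCarrier T4BoundaryRate

variable {C : T4BoundaryCarrier.Carriers}

/-! ## §1 The per-piece forms -/

/-- **`GenLipAt`** — the parent's hypothesis shape `GenLip` READ AT ONE PIECE `X` (same binder body; `genLip_iff`).  NOT PRINTED (as
`GenLip`); asserted for nothing of Bałaban's. [bookkeeping] [cite: Balaban1988Convergent, (3.27) p.271] -/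
def GenLipAt (G : Generation C) (BA : BFunctional C C.BgA) (BB : BFunctional C C.BgB)
    (EA : Functional C.toCarriers C.BgA) (EB : Functional C.toCarriers C.BgB) (W : Set (ℕ → ℝ)) (κ θ Cop : ℝ)
    (X : C.Dom) : Prop :=
  ∀ (D DE : C.Dom → ℝ),
    (∀ Y ∈ G.parents X, 0 ≤ D Y) → (∀ Y ∈ G.eparents X, 0 ≤ DE Y) →
    (∀ Y ∈ G.parents X, BDiscAt BA BB W κ D Y) → (∀ Y ∈ G.eparents X, EDiscAt EA EB W κ DE Y) →
    ∀ g ∈ W, ∀ (U : C.BgB), ∀ a ∈ C.admFl,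
      |BA g (C.transport U) a X - BB g U a X| ≤
        Cop * θ ^ C.scale X * Real.exp (-(κ * C.d X))
          + ∑ Y ∈ G.parents X, G.K X Y * (D Y * Real.exp (-(κ * C.d Y)))
          + ∑ Y ∈ G.eparents X, G.KE X Y * (DE Y * Real.exp (-(κ * C.d Y)))

/-- `GenLip` is `GenLipAt` at every piece — by definition. [folklore] -/
theorem genLip_iff {G : Generation C} {BA : BFunctional C C.BgA} {BB : BFunctional C C.BgB}
    {EA : Functional C.toCarriers C.BgA} {EB : Functional C.toCarriers C.BgB} {W : Set (ℕ → ℝ)} {κ θ Cop : ℝ} :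
    GenLip G BA BB EA EB W κ θ Cop ↔ ∀ X, GenLipAt G BA BB EA EB W κ θ Cop X := Iff.rfl

/-- `NE5B` is the parent's per-piece binder `BDiscAt` with the rate profile `C₅·θ^{scale}` at every piece (only the quantifier
order differs). [folklore] -/
theorem ne5B_iff_bDiscAt {BA : BFunctional C C.BgA} {BB : BFunctional C C.BgB} {W : Set (ℕ → ℝ)} {κ θ C₅ : ℝ} :
    NE5B BA BB W κ θ C₅ ↔ ∀ X, BDiscAt BA BB W κ (fun Y => C₅ * θ ^ C.scale Y) X := by
  constructor
  · intro h X g hg U a ha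
    simpa [atFl_apply] using h a ha g hg U X
  · intro h a ha g hg U X
    simpa [atFl_apply] using h X g hg U a ha

/-! ## §2 The base is printed: unpaired pieces -/

/-- **CONVENTION SHAPE `VanishesOn`** (bookkeeping, not a printed object): on the index set `S` run A has NO boundary piece — its
functional vanishes there (the unpaired first step of run B after node U5a's synchronisation). [bookkeeping]
[cite: Balaban1988Convergent, (2.40) p.261] -/
def VanishesOn (BA : BFunctional C C.BgA) (W : Set (ℕ → ℝ)) (S : Set C.Dom) : Prop :=
  ∀ g ∈ W, ∀ (V : C.BgA), ∀ a ∈ C.admFl, ∀ X ∈ S, BA g V a X = 0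

/-- At an unpaired piece the two-run discrepancy IS run B's one-run size. [folklore] -/
theorem disc_eq_of_vanishesOn {BA : BFunctional C C.BgA} {W : Set (ℕ → ℝ)} {S : Set C.Dom} (h : VanishesOn BA W S)
    (BB : BFunctional C C.BgB) {g : ℕ → ℝ} (hg : g ∈ W) (U : C.BgB) {a : C.Fl} (ha : a ∈ C.admFl) {X : C.Dom}
    (hX : X ∈ S) :
    |BA g (C.transport U) a X - BB g U a X| = |BB g U a X| := by
  rw [h g hg (C.transport U) a ha X hX, zero_sub, abs_neg]

/-- **THE BASE IS PRINTED** [folklore]: at an unpaired piece with NO parents and NO regular inputs, `GenLipAt` follows from the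
printed one-run bound (2.42) of run B in its typed form `DecayBoundFl BB W B₀ κ` (quoted leaf, binder) as soon as
`B₀ ≤ Cop·θ^{scale X}`. -/
theorem genLipAt_of_unpaired {G : Generation C} {BA : BFunctional C C.BgA} {BB : BFunctional C C.BgB}
    {EA : Functional C.toCarriers C.BgA} {EB : Functional C.toCarriers C.BgB} {W : Set (ℕ → ℝ)} {κ θ Cop B₀ : ℝ}
    {S : Set C.Dom} {X : C.Dom}
    (hX : X ∈ S) (hpar : G.parents X = ∅) (hepar : G.eparents X = ∅)
    (hA : VanishesOn BA W S) (hB : DecayBoundFl BB W B₀ κ) (hCop : B₀ ≤ Cop * θ ^ C.scale X) :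
    GenLipAt G BA BB EA EB W κ θ Cop X := by
  intro D DE _ _ _ _ g hg U a ha
  rw [hpar, hepar, sum_empty, sum_empty, add_zero, add_zero, disc_eq_of_vanishesOn hA BB hg U ha hX]
  have h1 : |BB g U a X| ≤ B₀ * Real.exp (-(κ * C.d X)) := by simpa [atFl_apply] using hB a ha g hg U X
  exact h1.trans (mul_le_mul_of_nonneg_right hCop (Real.exp_pos _).le)

/-- The TARGET INEQUALITY at an unpaired piece from the printed bound: `BDiscAt` with the rate profile `C₅·θ^{scale}` holds there as
soon as `B₀ ≤ C₅·θ^{scale X}` (no generation structure needed). [folklore] -/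
theorem bDiscAt_of_unpaired {BA : BFunctional C C.BgA} {BB : BFunctional C C.BgB} {W : Set (ℕ → ℝ)} {κ θ C₅ B₀ : ℝ}
    {S : Set C.Dom} {X : C.Dom} (hX : X ∈ S) (hA : VanishesOn BA W S) (hB : DecayBoundFl BB W B₀ κ)
    (hC : B₀ ≤ C₅ * θ ^ C.scale X) :
    BDiscAt BA BB W κ (fun Y => C₅ * θ ^ C.scale Y) X := by
  intro g hg U a ha
  rw [disc_eq_of_vanishesOn hA BB hg U ha hX]
  have h1 : |BB g U a X| ≤ B₀ * Real.exp (-(κ * C.d X)) := by simpa [atFl_apply] using hB a ha g hg U X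
  exact h1.trans (mul_le_mul_of_nonneg_right hC (Real.exp_pos _).le)

/-- Conversely, `NE5B` RESTRICTED TO THE UNPAIRED PIECES is nothing but a one-run bound on run B's pieces there, with constant
`C₅·θ^{scale X}` (≤ `C₅` when `0 ≤ θ ≤ 1`). [folklore] -/
theorem abs_le_of_ne5B_of_vanishesOn {BA : BFunctional C C.BgA} {BB : BFunctional C C.BgB} {W : Set (ℕ → ℝ)}
    {κ θ C₅ : ℝ} {S : Set C.Dom} (h5 : NE5B BA BB W κ θ C₅) (hA : VanishesOn BA W S)
    {g : ℕ → ℝ} (hg : g ∈ W) (U : C.BgB) {a : C.Fl} (ha : a ∈ C.admFl) {X : C.Dom} (hX : X ∈ S) :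
    |BB g U a X| ≤ C₅ * θ ^ C.scale X * Real.exp (-(κ * C.d X)) := by
  rw [← disc_eq_of_vanishesOn hA BB hg U ha hX]
  simpa [atFl_apply] using h5 a ha g hg U X

/-- The same with the constant `C₅` when `0 ≤ θ ≤ 1` and `0 ≤ C₅`: on the unpaired pieces `NE5B` is a `DecayBound`-type statement.
[folklore] -/
theorem abs_le_of_ne5B_of_vanishesOn' {BA : BFunctional C C.BgA} {BB : BFunctional C C.BgB} {W : Set (ℕ → ℝ)}
    {κ θ C₅ : ℝ} {S : Set C.Dom} (h5 : NE5B BA BB W κ θ C₅) (hA : VanishesOn BA W S) (hθ : 0 ≤ θ) (hθ1 : θ ≤ 1)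
    (hC : 0 ≤ C₅) {g : ℕ → ℝ} (hg : g ∈ W) (U : C.BgB) {a : C.Fl} (ha : a ∈ C.admFl) {X : C.Dom} (hX : X ∈ S) :
    |BB g U a X| ≤ C₅ * Real.exp (-(κ * C.d X)) := by
  have h := abs_le_of_ne5B_of_vanishesOn h5 hA hg U ha hX
  have hθn : θ ^ C.scale X ≤ 1 := pow_le_one₀ hθ hθ1
  have h2 : C₅ * θ ^ C.scale X * Real.exp (-(κ * C.d X)) ≤ C₅ * 1 * Real.exp (-(κ * C.d X)) :=
    mul_le_mul_of_nonneg_right (mul_le_mul_of_nonneg_left hθn hC) (Real.exp_pos _).le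
  linarith

/-! ## §3 The located reason for the `OpDisc` split: at a parentless piece `OpDisc` is the target inequality -/

/-- **AT A PARENTLESS PIECE THE `OpDisc` EXPRESSION IS THE TWO-RUN DISCREPANCY** [folklore]: with no parents and no regular
inputs, `InputLipB` makes run B's map TABLE-INDEPENDENT at `X` within the admissible class (both sums are empty), so — reading both
runs through `RepresentsA`/`RepresentsB` and using the admissibility of run A's transported tables and of run B's own tables — run
B's map fed with run A's transported tables equals run B's piece, and the `OpDisc` difference at `X` equals
`BA g (transport U) a X − BB g U a X`. -/
theorem opDisc_apply_eq_disc_of_noParents {G : Generation C} {ΦA : GenMap C C.BgA} {Φ : GenMap C C.BgB}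
    {BA : BFunctional C C.BgA} {BB : BFunctional C C.BgB}
    {EA : Functional C.toCarriers C.BgA} {EB : Functional C.toCarriers C.BgB} {W : Set (ℕ → ℝ)} {κ : ℝ}
    {Adm : (ℕ → ℝ) → BTable C C.BgB → ETable C C.BgB → Prop} {X : C.Dom}
    (hpar : G.parents X = ∅) (hepar : G.eparents X = ∅)
    (hRA : RepresentsA ΦA BA EA W) (hRB : RepresentsB Φ BB EB W) (hIL : InputLipB G Φ W κ Adm)
    (hadmA : ∀ g ∈ W, Adm g (pullB BA g) (epullB EA g)) (hadmB : ∀ g ∈ W, Adm g (tabB BB g) (etabB EB g))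
    {g : ℕ → ℝ} (hg : g ∈ W) (U : C.BgB) {a : C.Fl} (ha : a ∈ C.admFl) :
    ΦA g (tabA BA g) (etabA EA g) X (C.transport U) a - Φ g (pullB BA g) (epullB EA g) X U a
      = BA g (C.transport U) a X - BB g U a X := by
  have h0 := hIL g hg (pullB BA g) (tabB BB g) (epullB EA g) (etabB EB g) (hadmA g hg) (hadmB g hg) X
    (fun _ => 0) (fun _ => 0) (by simp [hpar]) (by simp [hepar]) (by simp [hpar]) (by simp [hepar]) U a ha
  rw [hpar, hepar, sum_empty, sum_empty, add_zero] at h0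
  have heq : Φ g (pullB BA g) (epullB EA g) X U a = Φ g (tabB BB g) (etabB EB g) X U a := by
    have := abs_nonpos_iff.mp h0
    linarith [this]
  rw [heq, ← hRB g hg X U a ha, ← hRA g hg X (C.transport U) a ha]

/-- Hence at a parentless piece `OpDisc` GIVES the target inequality with `C₅ = Cop` (the base case of the parent's induction, where
the estimate and the leaf coincide — the located reason why the ROUND-2 skeleton splits `OpDisc` into reading × one-run operator
modulus × operator η-rate, `Support/BoundaryRateOpDisc.opDisc_of_split`). [folklore] -/
theorem bDiscAt_of_opDisc_of_noParents {G : Generation C} {ΦA : GenMap C C.BgA} {Φ : GenMap C C.BgB}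
    {BA : BFunctional C C.BgA} {BB : BFunctional C C.BgB}
    {EA : Functional C.toCarriers C.BgA} {EB : Functional C.toCarriers C.BgB} {W : Set (ℕ → ℝ)} {κ θ Cop : ℝ}
    {Adm : (ℕ → ℝ) → BTable C C.BgB → ETable C C.BgB → Prop} {X : C.Dom}
    (hpar : G.parents X = ∅) (hepar : G.eparents X = ∅)
    (hRA : RepresentsA ΦA BA EA W) (hRB : RepresentsB Φ BB EB W) (hIL : InputLipB G Φ W κ Adm)
    (hadmA : ∀ g ∈ W, Adm g (pullB BA g) (epullB EA g)) (hadmB : ∀ g ∈ W, Adm g (tabB BB g) (etabB EB g))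
    (hOD : OpDisc ΦA Φ BA EA W κ θ Cop) :
    BDiscAt BA BB W κ (fun Y => Cop * θ ^ C.scale Y) X := by
  intro g hg U a ha
  rw [← opDisc_apply_eq_disc_of_noParents hpar hepar hRA hRB hIL hadmA hadmB hg U ha]
  exact hOD g hg X U a ha

/-- … and conversely the target inequality at a parentless piece gives `OpDisc`'s inequality there: the two statements COINCIDE at
such pieces. [folklore] -/
theorem opDisc_ineq_of_bDiscAt_of_noParents {G : Generation C} {ΦA : GenMap C C.BgA} {Φ : GenMap C C.BgB}
    {BA : BFunctional C C.BgA} {BB : BFunctional C C.BgB}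
    {EA : Functional C.toCarriers C.BgA} {EB : Functional C.toCarriers C.BgB} {W : Set (ℕ → ℝ)} {κ θ Cop : ℝ}
    {Adm : (ℕ → ℝ) → BTable C C.BgB → ETable C C.BgB → Prop} {X : C.Dom}
    (hpar : G.parents X = ∅) (hepar : G.eparents X = ∅)
    (hRA : RepresentsA ΦA BA EA W) (hRB : RepresentsB Φ BB EB W) (hIL : InputLipB G Φ W κ Adm)
    (hadmA : ∀ g ∈ W, Adm g (pullB BA g) (epullB EA g)) (hadmB : ∀ g ∈ W, Adm g (tabB BB g) (etabB EB g))
    (hD : BDiscAt BA BB W κ (fun Y => Cop * θ ^ C.scale Y) X)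
    {g : ℕ → ℝ} (hg : g ∈ W) (U : C.BgB) {a : C.Fl} (ha : a ∈ C.admFl) :
    |ΦA g (tabA BA g) (etabA EA g) X (C.transport U) a - Φ g (pullB BA g) (epullB EA g) X U a| ≤
      Cop * θ ^ C.scale X * Real.exp (-(κ * C.d X)) := by
  rw [opDisc_apply_eq_disc_of_noParents hpar hepar hRA hRB hIL hadmA hadmB hg U ha]
  exact hD g hg U a ha

/-! ## §4 Re-assembly: `GenLip` from the per-piece form off the unpaired set and the printed base on it -/

/-- `GenLip` holds as soon as `GenLipAt` holds off the unpaired set `S` and, on `S`, the pieces are parentless, run A vanishes and run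
B obeys the printed bound with `B₀ ≤ Cop·θ^{scale X}` — the induction base costs `Cop ≥ B₀·θ^{−scale}` on `S` and nothing else.
[folklore] -/
theorem genLip_of_off_and_unpaired {G : Generation C} {BA : BFunctional C C.BgA} {BB : BFunctional C C.BgB}
    {EA : Functional C.toCarriers C.BgA} {EB : Functional C.toCarriers C.BgB} {W : Set (ℕ → ℝ)} {κ θ Cop B₀ : ℝ}
    {S : Set C.Dom}
    (hoff : ∀ X, X ∉ S → GenLipAt G BA BB EA EB W κ θ Cop X)
    (hparS : ∀ X ∈ S, G.parents X = ∅) (heparS : ∀ X ∈ S, G.eparents X = ∅)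
    (hA : VanishesOn BA W S) (hB : DecayBoundFl BB W B₀ κ) (hCop : ∀ X ∈ S, B₀ ≤ Cop * θ ^ C.scale X) :
    GenLip G BA BB EA EB W κ θ Cop := by
  rw [genLip_iff]
  intro X
  by_cases hX : X ∈ S
  · exact genLipAt_of_unpaired hX (hparS X hX) (heparS X hX) hA hB (hCop X hX)
  · exact hoff X hX

end Summit.QuantumFields.BalabanUV.T4Continuum.BoundaryRateScaleZero
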